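import Summits.AtomisticToContinuum.FouriersLaw.Theses.LatticeLandauDamping
import HarnessLib

/-!
# `LatticeLandauDamping.AbelGreenKuboOfWindow` — the glue to the target, proved

Item `stmt-AtomisticToContinuum-14174` (support, route `LatticeLandauDamping`, sub-problem `FouriersLaw`).
Statement: `WindowDecomposition → NoDrudeWeight → PositiveDensity → AbelOfSpectralDensity → AbelGreenKubo`.

Proof (pure bookkeeping, folklore): fix the chain parameters `ω₂, lam, β, γ > 0` and `T > 0`.
`WindowDecomposition` supplies a shift-invariant Gibbs state `μ_T`, a `μ_T`-preserving infinite-volume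
dynamics `D` with absolutely convergent current correlations, a finite spectral measure `σ` with
`C_T(t) = ∫ cos(ωt) dσ(ω)`, and a window `(−δ, δ)` on which `σ = σ{0}·δ₀ + g dω` with `g` continuous and
non-negative.  `NoDrudeWeight` gives `σ{0} = 0`, so (`zero_smul`, `zero_add`) the window restriction of
`σ` is exactly `g dω`; `PositiveDensity` then gives `g 0 > 0`, and the Poisson-kernel lemma
`AbelOfSpectralDensity` gives `∫_{t>0} e^{−νt} C_T(t) dt → π·g 0` as `ν ↓ 0`.  Hence `AbelGreenKubo` holds
at `T` with the same `(μ_T, D)` and `κ := (T²)⁻¹·(π·g 0) > 0` (`Filter.Tendsto.const_mul`).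
The closing theorem is `abelGreenKuboOfWindow_proof`.
-/

namespace Summit.AtomisticToContinuum.FouriersLaw.Theorems

open Summit.AtomisticToContinuum.FouriersLaw.Theses.LatticeLandauDamping

/-- **Glue to the target** (item `stmt-AtomisticToContinuum-14174`, folklore):
`WindowDecomposition → NoDrudeWeight → PositiveDensity → AbelOfSpectralDensity → AbelGreenKubo`.
At each parameter point and each `T > 0`: take the window decomposition `(μ_T, D, σ, δ, g)`, kill the
atom at `0` with `NoDrudeWeight`, read `g 0 > 0` from `PositiveDensity`, apply the Poisson-kernel
lemma `AbelOfSpectralDensity` to `C_T = D.currentCorrelation μ_T`, and set `κ := (T²)⁻¹·(π·g 0)`. -/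
theorem abelGreenKuboOfWindow_proof :
    Summit.AtomisticToContinuum.FouriersLaw.Theses.LatticeLandauDamping.AbelGreenKuboOfWindow := by
  unfold Summit.AtomisticToContinuum.FouriersLaw.Theses.LatticeLandauDamping.AbelGreenKuboOfWindow
  intro hWD hND hPD hAbel ω₂ lam β γ hω hl hβ hγ T hT
  obtain ⟨μT, D, hGibbs, hshift, hpres, habs, σ, hfin, hC, δ, g, hδ, hg, hg0, hres⟩ :=
    hWD ω₂ lam β γ hω hl hβ hγ T hT
  -- no Drude weight: the atom at frequency 0 vanishes
  have h0 : σ {0} = 0 :=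
    hND ω₂ lam β γ hω hl hβ hγ T hT μT D hGibbs hshift hpres habs σ hfin hC
  rw [h0, zero_smul, zero_add] at hres
  -- not an insulator: the continuous density is positive at frequency 0
  have hpos : 0 < g 0 :=
    hPD ω₂ lam β γ hω hl hβ hγ T hT μT D hGibbs hshift hpres habs σ δ g hfin hδ hC hg hg0 hres
  -- Poisson-kernel lemma: the Abel means of `C_T` converge to `π·g 0`
  have hlim := hAbel σ (D.currentCorrelation μT) δ g hfin hδ hC hg hg0 hres
  refine ⟨μT, D, (T ^ 2)⁻¹ * (Real.pi * g 0), hGibbs, hpres, habs, by positivity, ?_⟩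
  exact hlim.const_mul ((T ^ 2)⁻¹)

end Summit.AtomisticToContinuum.FouriersLaw.Theorems
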